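import Literature.AlgebraicGeometry.Morphisms.GlueDataOverBase
import HarnessLib

/-!
# Relative gluing: schemes over the charts of a cocycle gluing, glued from a RELATIVE cocycle datum

[StacksProject, Tag 01LH] (relative glueing): «Let `S = ⋃ Uᵢ` be an open covering, `fᵢ : Xᵢ → Uᵢ` morphisms
of schemes, and `θᵢⱼ : fᵢ⁻¹(Uᵢ ∩ Uⱼ) → fⱼ⁻¹(Uᵢ ∩ Uⱼ)` isomorphisms over `Uᵢ ∩ Uⱼ` satisfying the cocycle condition
(over `Uᵢ ∩ Uⱼ ∩ Uₖ`).  Then there exist a morphism `f : X → S` and isomorphisms `f⁻¹(Uᵢ) ≅ Xᵢ` over `Uᵢ`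
recovering the `θᵢⱼ`.»  [GortzWedhorn2020] Prop. 3.10 + Prop. 3.5 (gluing of schemes and of morphisms).

Here the base `S = D.glued` is itself presented by glue data `D : Scheme.GlueData` in Mathlib's COCYCLE form
(charts `D.U i`, overlaps `D.f i j : D.V (i, j) ⟶ D.U i`, transition isomorphisms `D.t i j`, triple-overlap maps
`D.t' i j k` with `D.cocycle`), and the RELATIVE COCYCLE DATUM over it consists of

* `Z i`, a scheme over the chart, `z i : Z i ⟶ D.U i`;
* `θ i j : Z i ×_{U i} V (i, j) ⟶ Z j ×_{U j} V (j, i)`, a morphism LYING OVER `D.t i j` (`hθ`), with `θ i i = 𝟙` (`hθid`);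
* the cocycle condition `hcoc` on the canonical lifts `relativeT' i j k` of the `θ i j` to the triple overlaps
  `(Z i ×_{U i} V (i, j)) ×_{Z i} (Z i ×_{U i} V (i, k))`.

THIS FILE builds from it the glue datum `relativeGlueData … : Scheme.GlueData` (§2: `U := Z`,
`V (i, j) := Z i ×_{U i} D.V (i, j)`, `f i j := pullback.fst` — an open immersion, an isomorphism for `i = j` —,
`t := θ`, `t' := relativeT'`), after recording in §1 the map `relativeToBase i j k` from the relative to the base
triple overlap, the CARTESIAN square «relative triple overlap `= Z i ×_{U i}` base triple overlap»
(`isPullback_relativeToBase`), the components and the uniqueness of `relativeT'` (`relativeT'_snd`,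
`relativeT'_fst_fst`, `relativeT'_fst_snd`, `relativeT'_unique`), that `relativeT' i j k` lies over `D.t' i j k`
(`relativeT'_relativeToBase`), that the cocycle composite lies over the IDENTITY of the base triple overlap
(`relativeT'_cocycle_relativeToBase`, via `D.cocycle`) and that the cocycle condition is equivalent to its
`Z i`-component (`relativeT'_cocycle_iff`) — the two «rigidity sockets» through which a consumer discharges `hcoc`
when the `Z i ⟶ U i` are families without automorphisms.  §3 then applies ★ `GlueDataOverBase` §2–§3 with
`e := id`, `φ := z`, `φV i j := pullback.snd`: there is a UNIQUE `Φ : (relativeGlueData …).glued ⟶ D.glued` with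
`ι i ≫ Φ = z i ≫ D.ι i` (`relativeGlueData_existsUnique_map`), its charts are CARTESIAN — `Φ⁻¹(U i) = Z i`
(`relativeGlueData_isPullback_ι`, `relativeGlueData_preimage_range_ι`) — and `Φ` inherits every property local on
the target from the `z i` (`relativeGlueData_map_of_isZariskiLocalAtTarget`: proper, flat, smooth, …).

No named fact, no `sorry`, no instance; three definitions (`relativeToBase`, `relativeT'`, `relativeGlueData`), the
rest theorems.  The inverse hypothesis `θ i j ≫ θ j i = 𝟙` is NOT needed (Mathlib derives `t_inv` from the
cocycle).  Cell hodgecm-mathlib, F-DAG price sheet §5b hand (h7) «Zariski gluing of `S`-objects from a cocycle»,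
FILE 2 (sockets by B-p14 (g16)); consumer leaf F-8 (8c)/(8e): the universal family over the glued coarse-free
moduli scheme, glued from the restricted universal families.  HC_CM is proved only modulo the printed citations
until rung 0 closes; this file discharges none of them.

## References
* [StacksProject] The Stacks Project, Tag 01LH (Relative glueing), Tag 01JA (Glueing schemes).
* [GortzWedhorn2020] U. Görtz, T. Wedhorn, *Algebraic Geometry I*, 2nd ed. (2020), Section (3.3) Prop. 3.5,
  Section (3.5) Def. 3.9 / Prop. 3.10, Section (4.8) Lemma 4.28, Section (4.9) Def. 4.29.
-/

noncomputable section

universe u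

open CategoryTheory CategoryTheory.Limits AlgebraicGeometry TopologicalSpace

namespace Literature.AlgebraicGeometry.Morphisms

section Relative

variable (D : Scheme.GlueData.{u}) (Z : D.J → Scheme.{u}) (z : ∀ i, Z i ⟶ D.U i)

/-! ### §1 Relative overlaps, the map to the base triple overlap, and the lifted transition maps -/

/-- The map from the RELATIVE triple overlap `(Z i ×_{U i} V (i, j)) ×_{Z i} (Z i ×_{U i} V (i, k))` (the part of
`Z i` over `Uᵢ ∩ Uⱼ ∩ Uₖ`) to the BASE triple overlap `V (i, j) ×_{U i} V (i, k)` ([StacksProject, Tag 01LH]: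
«over `Uᵢ ∩ Uⱼ ∩ Uₖ`»): `pullback.map` with components the second projections, over `z i`.
[cite: StacksProject, Tag 01LH] [cite: GortzWedhorn2020, Section (4.8) Lemma 4.28] -/
def relativeToBase (i j k : D.J) :
    pullback (pullback.fst (z i) (D.f i j)) (pullback.fst (z i) (D.f i k)) ⟶ pullback (D.f i j) (D.f i k) :=
  pullback.map _ _ _ _ (pullback.snd (z i) (D.f i j)) (pullback.snd (z i) (D.f i k)) (z i)
    pullback.condition pullback.condition

/-- First component of `relativeToBase`: over `V (i, j)` it is the second projection of the first factor.
[cite: StacksProject, Tag 01LH] -/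
theorem relativeToBase_fst (i j k : D.J) :
    relativeToBase D Z z i j k ≫ pullback.fst (D.f i j) (D.f i k) =
      pullback.fst _ _ ≫ pullback.snd (z i) (D.f i j) :=
  pullback.lift_fst _ _ _

/-- Second component of `relativeToBase`: over `V (i, k)` it is the second projection of the second factor.
[cite: StacksProject, Tag 01LH] -/
theorem relativeToBase_snd (i j k : D.J) :
    relativeToBase D Z z i j k ≫ pullback.snd (D.f i j) (D.f i k) =
      pullback.snd _ _ ≫ pullback.snd (z i) (D.f i k) :=
  pullback.lift_snd _ _ _

/-- **The relative triple overlap is the restriction of the family `Z i ⟶ U i` to the base triple overlap**: the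
square formed by the projection `(Z i ×_{U i} V (i, j)) ×_{Z i} (Z i ×_{U i} V (i, k)) ⟶ Z i`, `relativeToBase`,
`z i` and `V (i, j) ×_{U i} V (i, k) ⟶ U i` is CARTESIAN (pasting of pull-back squares,
[GortzWedhorn2020] Section (4.8); set-theoretically `zᵢ⁻¹(Uᵢⱼ) ∩ zᵢ⁻¹(Uᵢₖ) = zᵢ⁻¹(Uᵢⱼ ∩ Uᵢₖ)`).  This is what lets a
consumer read the cocycle composite as an automorphism of the RESTRICTED FAMILY over the triple overlap.
[cite: StacksProject, Tag 01LH] [cite: GortzWedhorn2020, Section (4.8) Lemma 4.28] -/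
theorem isPullback_relativeToBase (i j k : D.J) :
    IsPullback (pullback.fst (pullback.fst (z i) (D.f i j)) (pullback.fst (z i) (D.f i k)) ≫
        pullback.fst (z i) (D.f i j))
      (relativeToBase D Z z i j k) (z i) (pullback.fst (D.f i j) (D.f i k) ≫ D.f i j) := by
  -- outer rectangle: relative triple overlap ⟶ Z i ×_{U i} V (i, k) ⟶ V (i, k) over Z i ×_{U i} V (i, j) ⟶ Z i ⟶ U i
  have h1 : IsPullback
      (pullback.snd (pullback.fst (z i) (D.f i j)) (pullback.fst (z i) (D.f i k)) ≫ pullback.snd (z i) (D.f i k))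
      (pullback.fst (pullback.fst (z i) (D.f i j)) (pullback.fst (z i) (D.f i k))) (D.f i k)
      (pullback.fst (z i) (D.f i j) ≫ z i) :=
    (IsPullback.of_hasPullback (pullback.fst (z i) (D.f i j)) (pullback.fst (z i) (D.f i k))).flip.paste_horiz
      (IsPullback.of_hasPullback (z i) (D.f i k)).flip
  rw [pullback.condition] at h1
  -- the same rectangle read through the base triple overlap
  have h2 : IsPullback (relativeToBase D Z z i j k ≫ pullback.snd (D.f i j) (D.f i k))
      (pullback.fst (pullback.fst (z i) (D.f i j)) (pullback.fst (z i) (D.f i k))) (D.f i k)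
      (pullback.snd (z i) (D.f i j) ≫ D.f i j) := by
    rw [relativeToBase_snd]
    exact h1
  have h3 : IsPullback (relativeToBase D Z z i j k)
      (pullback.fst (pullback.fst (z i) (D.f i j)) (pullback.fst (z i) (D.f i k)))
      (pullback.fst (D.f i j) (D.f i k)) (pullback.snd (z i) (D.f i j)) :=
    h2.of_right (relativeToBase_fst D Z z i j k) (IsPullback.of_hasPullback (D.f i j) (D.f i k)).flip
  exact (h3.paste_vert (IsPullback.of_hasPullback (z i) (D.f i j)).flip).flip

variable (θ : ∀ i j, pullback (z i) (D.f i j) ⟶ pullback (z j) (D.f j i))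
  (hθ : ∀ i j, θ i j ≫ pullback.snd (z j) (D.f j i) = pullback.snd (z i) (D.f i j) ≫ D.t i j)

/-- **The transition map on relative triple overlaps** (the `t'` of the relative glue datum): the canonical lift of
`θ i j` to `(Z i ×_{U i} V (i, j)) ×_{Z i} (Z i ×_{U i} V (i, k)) ⟶ (Z j ×_{U j} V (j, k)) ×_{Z j} (Z j ×_{U j} V (j, i))`
— its `V (j, i)`-factor is `pullback.fst ≫ θ i j` (`relativeT'_snd`), its `V (j, k)`-factor has `Z j`-component
`pullback.fst ≫ θ i j ≫ pullback.fst` and `V (j, k)`-component `relativeToBase ≫ D.t' i j k ≫ pullback.fst`; the two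
agree over `U j` because `θ i j` lies over `D.t i j` (`hθ`) and `D.t' i j k` lies over `D.t i j` (`D.t_fac`).
[StacksProject, Tag 01LH]: «`θᵢⱼ` restricted to `Uᵢ ∩ Uⱼ ∩ Uₖ`». [cite: StacksProject, Tag 01LH]
[cite: GortzWedhorn2020, Section (3.5) Definition 3.9] -/
def relativeT' (i j k : D.J) :
    pullback (pullback.fst (z i) (D.f i j)) (pullback.fst (z i) (D.f i k)) ⟶
      pullback (pullback.fst (z j) (D.f j k)) (pullback.fst (z j) (D.f j i)) :=
  pullback.lift
    (pullback.lift
      (pullback.fst (pullback.fst (z i) (D.f i j)) (pullback.fst (z i) (D.f i k)) ≫ θ i j ≫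
        pullback.fst (z j) (D.f j i))
      (relativeToBase D Z z i j k ≫ D.t' i j k ≫ pullback.fst (D.f j k) (D.f j i))
      (by
        simp only [Category.assoc]
        rw [pullback.condition, reassoc_of% (hθ i j), pullback.condition, D.t_fac_assoc,
          reassoc_of% (relativeToBase_fst D Z z i j k)]))
    (pullback.fst (pullback.fst (z i) (D.f i j)) (pullback.fst (z i) (D.f i k)) ≫ θ i j)
    (by rw [pullback.lift_fst, Category.assoc])

/-- `relativeT' i j k` LIES OVER `θ i j`: its `Z j ×_{U j} V (j, i)`-factor is `pullback.fst ≫ θ i j` (the `t_fac`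
axiom of the relative glue datum). [cite: StacksProject, Tag 01LH] -/
theorem relativeT'_snd (i j k : D.J) :
    relativeT' D Z z θ hθ i j k ≫ pullback.snd _ _ = pullback.fst _ _ ≫ θ i j :=
  pullback.lift_snd _ _ _

/-- The `Z j`-component of `relativeT' i j k` (through the `V (j, k)`-factor) is `pullback.fst ≫ θ i j ≫ pullback.fst`.
[cite: StacksProject, Tag 01LH] -/
theorem relativeT'_fst_fst (i j k : D.J) :
    relativeT' D Z z θ hθ i j k ≫ pullback.fst _ _ ≫ pullback.fst (z j) (D.f j k) =
      pullback.fst _ _ ≫ θ i j ≫ pullback.fst (z j) (D.f j i) := by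
  rw [← Category.assoc]
  unfold relativeT'
  rw [pullback.lift_fst, pullback.lift_fst]

/-- The `V (j, k)`-component of `relativeT' i j k` is `relativeToBase ≫ D.t' i j k ≫ pullback.fst` (it lies over the
base transition map on triple overlaps). [cite: StacksProject, Tag 01LH] -/
theorem relativeT'_fst_snd (i j k : D.J) :
    relativeT' D Z z θ hθ i j k ≫ pullback.fst _ _ ≫ pullback.snd (z j) (D.f j k) =
      relativeToBase D Z z i j k ≫ D.t' i j k ≫ pullback.fst (D.f j k) (D.f j i) := by
  rw [← Category.assoc]
  unfold relativeT'
  rw [pullback.lift_fst, pullback.lift_snd]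

/-- **Uniqueness of the lift**: `relativeT' i j k` is the ONLY morphism of relative triple overlaps lying over
`θ i j` (the projection `pullback.snd` to `Z j ×_{U j} V (j, i)` is a monomorphism, being a base change of the open
immersion `Z j ×_{U j} V (j, k) ⟶ Z j`). [cite: StacksProject, Tag 01LH] -/
theorem relativeT'_unique (i j k : D.J)
    (g : pullback (pullback.fst (z i) (D.f i j)) (pullback.fst (z i) (D.f i k)) ⟶
      pullback (pullback.fst (z j) (D.f j k)) (pullback.fst (z j) (D.f j i)))
    (hg : g ≫ pullback.snd _ _ = pullback.fst _ _ ≫ θ i j) : g = relativeT' D Z z θ hθ i j k := by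
  rw [← cancel_mono (pullback.snd (pullback.fst (z j) (D.f j k)) (pullback.fst (z j) (D.f j i))), hg,
    relativeT'_snd]

/-- **`relativeT' i j k` lies over the base transition map `D.t' i j k`** (a morphism of restricted families
covering `Uᵢ ∩ Uⱼ ∩ Uₖ ⥲ Uⱼ ∩ Uₖ ∩ Uᵢ`): `relativeT' i j k ≫ relativeToBase j k i = relativeToBase i j k ≫ D.t' i j k`.
[cite: StacksProject, Tag 01LH] -/
theorem relativeT'_relativeToBase (i j k : D.J) :
    relativeT' D Z z θ hθ i j k ≫ relativeToBase D Z z j k i = relativeToBase D Z z i j k ≫ D.t' i j k := by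
  apply pullback.hom_ext
  · rw [Category.assoc, Category.assoc, relativeToBase_fst, relativeT'_fst_snd]
  · rw [Category.assoc, Category.assoc, relativeToBase_snd, D.t_fac, ← Category.assoc, relativeT'_snd,
      Category.assoc, hθ, ← Category.assoc, ← relativeToBase_fst D Z z i j k, Category.assoc]

/-- **The cocycle composite lies over the IDENTITY of the base triple overlap** (first rigidity socket): by
`D.cocycle`, `(relativeT' i j k ≫ relativeT' j k i ≫ relativeT' k i j) ≫ relativeToBase i j k = relativeToBase i j k`
— so the composite is an endomorphism of the restricted family `Z i|_{Uᵢⱼₖ} ⟶ Uᵢⱼₖ` OVER the base, and a consumer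
whose families have no non-trivial automorphisms concludes `hcoc`. [cite: StacksProject, Tag 01LH] -/
theorem relativeT'_cocycle_relativeToBase (i j k : D.J) :
    (relativeT' D Z z θ hθ i j k ≫ relativeT' D Z z θ hθ j k i ≫ relativeT' D Z z θ hθ k i j) ≫
        relativeToBase D Z z i j k = relativeToBase D Z z i j k := by
  rw [Category.assoc, Category.assoc, relativeT'_relativeToBase, ← Category.assoc (relativeT' D Z z θ hθ j k i),
    relativeT'_relativeToBase, Category.assoc, ← Category.assoc (relativeT' D Z z θ hθ i j k),
    relativeT'_relativeToBase, Category.assoc, D.cocycle, Category.comp_id]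

/-- **The cocycle condition is equivalent to its `Z i`-component** (second rigidity socket): since the projection of
the relative triple overlap to `Z i` is a monomorphism (a composite of open immersions), the composite
`relativeT' i j k ≫ relativeT' j k i ≫ relativeT' k i j` is the identity iff it fixes the projection to `Z i`.
[cite: StacksProject, Tag 01LH] -/
theorem relativeT'_cocycle_iff (i j k : D.J) :
    relativeT' D Z z θ hθ i j k ≫ relativeT' D Z z θ hθ j k i ≫ relativeT' D Z z θ hθ k i j = 𝟙 _ ↔
      (relativeT' D Z z θ hθ i j k ≫ relativeT' D Z z θ hθ j k i ≫ relativeT' D Z z θ hθ k i j) ≫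
          pullback.fst _ _ ≫ pullback.fst (z i) (D.f i j) =
        pullback.fst _ _ ≫ pullback.fst (z i) (D.f i j) := by
  constructor
  · intro h
    rw [h, Category.id_comp]
  · intro h
    rw [← cancel_mono (pullback.fst (pullback.fst (z i) (D.f i j)) (pullback.fst (z i) (D.f i k)) ≫
      pullback.fst (z i) (D.f i j)), h, Category.id_comp]

/-! ### §2 The relative glue datum -/

variable (hθid : ∀ i, θ i i = 𝟙 _)
  (hcoc : ∀ i j k, relativeT' D Z z θ hθ i j k ≫ relativeT' D Z z θ hθ j k i ≫ relativeT' D Z z θ hθ k i j = 𝟙 _)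

/-- **The glue datum of a relative cocycle datum** ([StacksProject, Tag 01LH]; [GortzWedhorn2020] Def. 3.9):
charts `Z i`, overlaps `Z i ×_{U i} V (i, j) ⟶ Z i` (open immersions, base changes of the `D.f i j`; isomorphisms
for `i = j`), transition maps `θ i j` (`θ i i = 𝟙`), triple-overlap maps `relativeT' i j k` (`t_fac` =
`relativeT'_snd`) and the cocycle `hcoc`.  Built with the `Scheme.GlueData` constructor directly, so that
`U`, `V`, `f`, `t`, `t'` are definitionally the data above. [cite: StacksProject, Tag 01LH]
[cite: GortzWedhorn2020, Section (3.5) Definition 3.9] -/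
@[implicit_reducible]
def relativeGlueData : Scheme.GlueData.{u} where
  J := D.J
  U := Z
  V := fun ij => pullback (z ij.1) (D.f ij.1 ij.2)
  f i j := pullback.fst (z i) (D.f i j)
  f_id i := inferInstance
  t := θ
  t_id := hθid
  t' := relativeT' D Z z θ hθ
  t_fac i j k := relativeT'_snd D Z z θ hθ i j k
  cocycle := hcoc
  f_open _ _ := inferInstance

/-- The index type of the relative glue datum is that of the base. [cite: StacksProject, Tag 01LH] -/
theorem relativeGlueData_J : (relativeGlueData D Z z θ hθ hθid hcoc).J = D.J := rfl

/-- The charts of the relative glue datum are the `Z i`. [cite: StacksProject, Tag 01LH] -/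
theorem relativeGlueData_U (i : D.J) : (relativeGlueData D Z z θ hθ hθid hcoc).U i = Z i := rfl

/-- The overlaps of the relative glue datum are the `Z i ×_{U i} V (i, j)`. [cite: StacksProject, Tag 01LH] -/
theorem relativeGlueData_V (i j : D.J) :
    (relativeGlueData D Z z θ hθ hθid hcoc).V (i, j) = pullback (z i) (D.f i j) := rfl

/-- The overlap inclusions of the relative glue datum are the first projections. [cite: StacksProject, Tag 01LH] -/
theorem relativeGlueData_f (i j : D.J) :
    (relativeGlueData D Z z θ hθ hθid hcoc).f i j = pullback.fst (z i) (D.f i j) := rfl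

/-- The transition maps of the relative glue datum are the `θ i j`. [cite: StacksProject, Tag 01LH] -/
theorem relativeGlueData_t (i j : D.J) : (relativeGlueData D Z z θ hθ hθid hcoc).t i j = θ i j := rfl

/-- The triple-overlap maps of the relative glue datum are the `relativeT' i j k`. [cite: StacksProject, Tag 01LH] -/
theorem relativeGlueData_t' (i j k : D.J) :
    (relativeGlueData D Z z θ hθ hθid hcoc).t' i j k = relativeT' D Z z θ hθ i j k := rfl

/-! ### §3 The glued morphism to the base and its cartesian charts -/

/-- **Relative glueing, existence and uniqueness of the morphism to the base** ([StacksProject, Tag 01LH]: «there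
exists a morphism `f : X → S`»; [GortzWedhorn2020] Prop. 3.5): there is a UNIQUE
`Φ : (relativeGlueData …).glued ⟶ D.glued` whose restriction to the chart `Z i` is `z i ≫ D.ι i` — ★
`glueData_existsUnique_map` with `e := id`, `φ := z`, `φV i j := pullback.snd` (`hf` = `pullback.condition`,
`ht` = `hθ`). [cite: StacksProject, Tag 01LH] [cite: GortzWedhorn2020, Section (3.3) Proposition 3.5] -/
theorem relativeGlueData_existsUnique_map :
    ∃! Φ : (relativeGlueData D Z z θ hθ hθid hcoc).glued ⟶ D.glued,
      ∀ i, (relativeGlueData D Z z θ hθ hθid hcoc).ι i ≫ Φ = z i ≫ D.ι i :=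
  glueData_existsUnique_map (relativeGlueData D Z z θ hθ hθid hcoc) D id z
    (fun i j => pullback.snd (z i) (D.f i j)) (fun i j => (pullback.condition (f := z i) (g := D.f i j)).symm)
    (fun i j => (hθ i j).symm)

/-- **The charts of the glued morphism are CARTESIAN** ([StacksProject, Tag 01LH]: «isomorphisms `f⁻¹(Uᵢ) ≅ Xᵢ`
over `Uᵢ`»): for any `Φ` glued from the `z i` and every `i`, the square `Z i ⟶ (relativeGlueData …).glued`, `z i`,
`Φ`, `D.U i ⟶ D.glued` is a pull-back — ★ `glueData_isPullback_ι_map`, the overlap squares being cartesian by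
construction (`IsPullback.of_hasPullback`). [cite: StacksProject, Tag 01LH]
[cite: GortzWedhorn2020, Section (3.5) Proposition 3.10 and Section (4.8) Lemma 4.28] -/
theorem relativeGlueData_isPullback_ι (Φ : (relativeGlueData D Z z θ hθ hθid hcoc).glued ⟶ D.glued)
    (hΦ : ∀ i, (relativeGlueData D Z z θ hθ hθid hcoc).ι i ≫ Φ = z i ≫ D.ι i) (i : D.J) :
    IsPullback ((relativeGlueData D Z z θ hθ hθid hcoc).ι i) (z i) Φ (D.ι i) :=
  glueData_isPullback_ι_map (D₁ := relativeGlueData D Z z θ hθ hθid hcoc) (D₂ := D) (e := id) (φ := z)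
    (φV := fun i j => pullback.snd (z i) (D.f i j)) (fun i j => IsPullback.of_hasPullback (z i) (D.f i j)) Φ hΦ i

/-- Set-theoretic reading: a point of the glued scheme maps under `Φ` into the chart `U i` of the base iff it lies
in the chart `Z i`. [cite: StacksProject, Tag 01LH] -/
theorem relativeGlueData_preimage_range_ι (Φ : (relativeGlueData D Z z θ hθ hθid hcoc).glued ⟶ D.glued)
    (hΦ : ∀ i, (relativeGlueData D Z z θ hθ hθid hcoc).ι i ≫ Φ = z i ≫ D.ι i) (i : D.J) :
    Φ ⁻¹' Set.range (D.ι i) = Set.range ((relativeGlueData D Z z θ hθ hθid hcoc).ι i) :=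
  glueData_preimage_range_ι_map (D₁ := relativeGlueData D Z z θ hθ hθid hcoc) (D₂ := D) (e := id) (φ := z)
    (φV := fun i j => pullback.snd (z i) (D.f i j)) (fun i j => IsPullback.of_hasPullback (z i) (D.f i j)) Φ hΦ i

/-- **The glued morphism inherits every property local on the target from the `z i`** ([GortzWedhorn2020]
Def. 4.29; e.g. `IsProper`, `Flat`, `Smooth`, `IsSeparated`, `LocallyOfFiniteType`, `IsIso`): ★
`glueData_map_of_isZariskiLocalAtTarget` with `e := id` (onto) and the cartesian overlap squares.
[cite: GortzWedhorn2020, Section (4.9) Definition 4.29] [cite: StacksProject, Tag 01LH] -/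
theorem relativeGlueData_map_of_isZariskiLocalAtTarget (P : MorphismProperty Scheme.{u})
    [IsZariskiLocalAtTarget P] (Φ : (relativeGlueData D Z z θ hθ hθid hcoc).glued ⟶ D.glued)
    (hΦ : ∀ i, (relativeGlueData D Z z θ hθ hθid hcoc).ι i ≫ Φ = z i ≫ D.ι i) (h : ∀ i, P (z i)) : P Φ :=
  glueData_map_of_isZariskiLocalAtTarget (D₁ := relativeGlueData D Z z θ hθ hθid hcoc) (D₂ := D) (e := id)
    (φ := z) (φV := fun i j => pullback.snd (z i) (D.f i j)) P Function.surjective_id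
    (fun i j => IsPullback.of_hasPullback (z i) (D.f i j)) Φ hΦ h

/-- **The glued morphism is a morphism OVER any base under `D.glued`**: if `q : D.glued ⟶ S` is glued from
`p i : D.U i ⟶ S` (★ `glueData_existsUnique_desc`), then `Φ ≫ q` is glued from the `z i ≫ p i`.
[cite: StacksProject, Tag 01LH] [cite: GortzWedhorn2020, Section (3.3) Proposition 3.5] -/
theorem relativeGlueData_ι_map_desc {S : Scheme.{u}} (p : ∀ i, D.U i ⟶ S) (q : D.glued ⟶ S)
    (hq : ∀ i, D.ι i ≫ q = p i) (Φ : (relativeGlueData D Z z θ hθ hθid hcoc).glued ⟶ D.glued)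
    (hΦ : ∀ i, (relativeGlueData D Z z θ hθ hθid hcoc).ι i ≫ Φ = z i ≫ D.ι i) (i : D.J) :
    (relativeGlueData D Z z θ hθ hθid hcoc).ι i ≫ Φ ≫ q = (z i ≫ p i) := by
  rw [← Category.assoc, hΦ, Category.assoc, hq]

end Relative

end Literature.AlgebraicGeometry.Morphisms

end
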